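import Mathlib.Analysis.SpecialFunctions.Gamma.Beta
import Mathlib.Analysis.Analytic.Binomial
import Mathlib.Analysis.Calculus.SmoothSeries
import Mathlib.Analysis.Complex.AbelLimit
import Literature.Probability.RandomPlanarGeometry.CritPercCardyFunctionProofs
import HarnessLib

/-!
# Cardy's function is the regularised incomplete beta function

This file discharges the named fact `Literature.Probability.RandomPlanarGeometry.cardyFunction_eq_incBeta13_div` of
`Literature.Probability.RandomPlanarGeometry.CritPercCardyFunctionProofs`:

`F(η) = (3 Γ(2/3) / Γ(1/3)²) η^{1/3} ₂F₁(1/3, 2/3; 4/3; η) = B(η; 1/3, 1/3) / B(1/3, 1/3)`, `η ∈ [0, 1]`,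

where `B(η; 1/3, 1/3) = ∫_0^η (s(1-s))^{-2/3} ds` (`Literature.Probability.RandomPlanarGeometry.incBeta13`). This is Cardy's eq. (8)
(`dF/dη ∝ (η(1-η))^{-2/3}`, Cardy 1992) integrated, i.e. Gauss's identity
`B_x(a, b) = (x^a / a) ₂F₁(a, 1 - b; a + 1; x)` (Beals–Wong 2016, §10.7, Exercise 4) at
`a = b = 1/3` together with Euler's `B(1/3, 1/3) = Γ(1/3)²/Γ(2/3)` (Andrews–Askey–Roy 1999,
Thm 1.1.4) and, at the endpoint `η = 1`, Gauss's summation theorem in the guise of Abel's limit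
theorem.

As corollaries it discharges every named fact of
`Literature.Probability.RandomPlanarGeometry.CardyFunction` (`Literature.Probability.RandomPlanarGeometry.cardyFunction_one`,
`Literature.Probability.RandomPlanarGeometry.continuousOn_cardyFunction`, `Literature.Probability.RandomPlanarGeometry.strictMonoOn_cardyFunction`, `Literature.Probability.RandomPlanarGeometry.cardyFunction_mem_Icc`,
`Literature.Probability.RandomPlanarGeometry.cardyFunction_one_sub`, `Literature.Probability.RandomPlanarGeometry.hasDerivAt_cardyFunction`,
`Literature.Probability.RandomPlanarGeometry.summable_ordinaryHypergeometricSeries_cardy_one`) and **crit-perc.S17**'s bundle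
`Literature.Probability.RandomPlanarGeometry.cardyFunction_props` (all `_holds` theorems at the end of the file). (As the reviewer
of `CritPercCardyFunctionProofs` observed, `cardyFunction_eq_incBeta13_div` is equivalent to the
conjunction of `hasDerivAt_cardyFunction`, `continuousOn_cardyFunction` and `cardyFunction_one` by
the fundamental theorem of calculus; here all of them are proved outright from the series.)

## Proof sketch

* `B(1/3,1/3) = Γ(1/3)²/Γ(2/3)`: Mathlib's `Complex.Gamma_mul_Gamma_eq_betaIntegral`, after
  identifying `Complex.betaIntegral (1/3) (1/3)` with the real interval integral `incBeta13 1`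
  (`Literature.Probability.RandomPlanarGeometry.incBeta13_one_eq_Gamma`); hence `cardyConst · B(1/3,1/3) = 3`.
* On `[0, 1)`: with `α_n = (1/3)_n (2/3)_n / ((4/3)_n n!)` (`Literature.Probability.RandomPlanarGeometry.cardyCoeff`, the Gauss series of
  `₂F₁(1/3,2/3;4/3;·)`) and `β_n = (2/3)_n / n!` (`Literature.Probability.RandomPlanarGeometry.binomCoeff23`, the binomial series of
  `(1 - y)^{-2/3}`, Mathlib `Real.one_div_one_sub_rpow_hasFPowerSeriesOnBall_zero`) one has
  `α_n (3n + 1) = β_n`; hence `P(t) = t ₂F₁(t³) = ∑ α_n t^{3n+1}` (`Literature.Probability.RandomPlanarGeometry.cardyP`) has derivative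
  `∑ β_n t^{3n} = (1 - t³)^{-2/3}` on `(-1, 1)` (termwise differentiation,
  `hasDerivAt_tsum_of_isPreconnected`), and so does `B(t³; 1/3,1/3)/3` on `(0, 1)` (FTC); both vanish
  at `0`, so `3 t ₂F₁(t³) = B(t³)` on `[0, 1)`, i.e. `3 η^{1/3} ₂F₁(η) = B(η)` (`t = η^{1/3}`).
* At `η = 1`: the partial sums of `∑ α_n` (`α_n ≥ 0`) are bounded by `B(1)/3` (let `x → 1⁻` in
  `∑_{n<N} α_n x^n ≤ ₂F₁(x) = B(x)/(3x^{1/3})`), so the series converges and Abel's limit theorem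
  (Mathlib `Real.tendsto_tsum_powerSeries_nhdsWithin_lt`) gives `3 ₂F₁(1) = 3 ∑ α_n = B(1)`; this is
  Gauss's `₂F₁(1/3,2/3;4/3;1) = Γ(4/3)Γ(1/3)/(Γ(1)Γ(2/3))`.

## References

* J. Cardy, *Critical percolation in finite geometries*, J. Phys. A 25 (1992) L201–L206, eqs. (8), (11).
* R. Beals, R. Wong, *Special Functions and Orthogonal Polynomials*, CUP (2016), §10.7 Exercise 4.
* G. E. Andrews, R. Askey, R. Roy, *Special Functions*, CUP (1999), Def. 1.1.3, Thm 1.1.4, and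
  Thm 2.2.2 (Gauss's summation theorem).
* C. F. Gauss, *Disquisitiones generales circa seriem infinitam* (1812).
-/

open Set Filter Topology MeasureTheory Polynomial
open scoped Nat

noncomputable section

namespace Literature.Probability.RandomPlanarGeometry

/-! ### Euler's beta integral: `B(1/3, 1/3) = Γ(1/3)² / Γ(2/3)` -/

/-- `u ↦ B(u; 1/3, 1/3)` is continuous on `[0, 1]` (a primitive of an integrable function). [folklore] -/
theorem incBeta13_continuousOn : ContinuousOn incBeta13 (Icc 0 1) := by
  have := intervalIntegral.continuousOn_primitive_interval' intervalIntegrable_betaKernel13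
    (a := 0) (by simp)
  rwa [uIcc_of_le zero_le_one] at this

/-- Mathlib's complex beta integral `Β(1/3, 1/3)` is the real number `B(1; 1/3, 1/3) = incBeta13 1`
(Andrews–Askey–Roy 1999, Def. 1.1.3). [cite: AndrewsAskeyRoy1999, Def. 1.1.3] -/
theorem betaIntegral_third_third : Complex.betaIntegral (1 / 3) (1 / 3) = (incBeta13 1 : ℂ) := by
  rw [Complex.betaIntegral, incBeta13, ← intervalIntegral.integral_ofReal]
  refine intervalIntegral.integral_congr_ae ?_
  refine Filter.Eventually.of_forall fun x hx => ?_
  rw [uIoc_of_le zero_le_one] at hx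
  have hx0 : 0 ≤ x := hx.1.le
  have hx1 : 0 ≤ 1 - x := by linarith [hx.2]
  have e : (1 / 3 : ℂ) - 1 = ((-(2 / 3) : ℝ) : ℂ) := by push_cast; norm_num
  rw [e, ← Complex.ofReal_one, ← Complex.ofReal_sub, ← Complex.ofReal_cpow hx0,
    ← Complex.ofReal_cpow hx1, ← Complex.ofReal_mul, betaKernel13, Real.mul_rpow hx0 hx1]

/-- **Euler's beta integral** at `(1/3, 1/3)`: `B(1/3, 1/3) = Γ(1/3)² / Γ(2/3)`
(Andrews–Askey–Roy 1999, Thm 1.1.4, `B(x, y) = Γ(x)Γ(y)/Γ(x + y)`; Mathlib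
`Complex.Gamma_mul_Gamma_eq_betaIntegral`). [cite: AndrewsAskeyRoy1999, Thm 1.1.4] -/
theorem incBeta13_one_eq_Gamma :
    incBeta13 1 = Real.Gamma (1 / 3) ^ 2 / Real.Gamma (2 / 3) := by
  have h := Complex.Gamma_mul_Gamma_eq_betaIntegral (s := 1 / 3) (t := 1 / 3)
    (by norm_num) (by norm_num)
  rw [betaIntegral_third_third, show (1 / 3 : ℂ) + 1 / 3 = 2 / 3 by norm_num,
    show (1 / 3 : ℂ) = ((1 / 3 : ℝ) : ℂ) by push_cast; rfl,
    show (2 / 3 : ℂ) = ((2 / 3 : ℝ) : ℂ) by push_cast; rfl,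
    Complex.Gamma_ofReal, Complex.Gamma_ofReal] at h
  have h' : Real.Gamma (1 / 3) * Real.Gamma (1 / 3) = Real.Gamma (2 / 3) * incBeta13 1 := by
    exact_mod_cast h
  have hG : Real.Gamma (2 / 3) ≠ 0 := (Real.Gamma_pos_of_pos (by norm_num)).ne'
  field_simp
  linarith [h']

/-- Cardy's normalisation: `cardyConst · B(1/3, 1/3) = (3Γ(2/3)/Γ(1/3)²) · Γ(1/3)²/Γ(2/3) = 3`
(Cardy 1992, eq. (11)). [cite: Cardy1992, eq. (11)] -/
theorem cardyConst_mul_incBeta13_one : cardyConst * incBeta13 1 = 3 := by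
  rw [cardyConst, incBeta13_one_eq_Gamma]
  have h1 : Real.Gamma (2 / 3) ≠ 0 := (Real.Gamma_pos_of_pos (by norm_num)).ne'
  have h2 : Real.Gamma (1 / 3) ≠ 0 := (Real.Gamma_pos_of_pos (by norm_num)).ne'
  field_simp

/-! ### The Gauss series of `₂F₁(1/3, 2/3; 4/3; ·)` and the binomial series of `(1 - y)^{-2/3}` -/

/-- The coefficients `α_n = (1/3)_n (2/3)_n / ((4/3)_n n!)` of the Gauss series
`₂F₁(1/3, 2/3; 4/3; x) = ∑ α_n x^n` (Andrews–Askey–Roy 1999, Def. 2.1.5; Mathlib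
`ordinaryHypergeometricSeries`). [cite: AndrewsAskeyRoy1999, Def. 2.1.5] -/
def cardyCoeff (n : ℕ) : ℝ :=
  ((n ! : ℝ)⁻¹ * (ascPochhammer ℝ n).eval (1 / 3 : ℝ) * (ascPochhammer ℝ n).eval (2 / 3 : ℝ) *
    ((ascPochhammer ℝ n).eval (4 / 3 : ℝ))⁻¹)

/-- The coefficients `β_n = (2/3)_n / n!` of the binomial series `(1 - y)^{-2/3} = ∑ β_n y^n`
(Andrews–Askey–Roy 1999, eq. (2.1.6)). [cite: AndrewsAskeyRoy1999, eq. (2.1.6)] -/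
def binomCoeff23 (n : ℕ) : ℝ := (n ! : ℝ)⁻¹ * (ascPochhammer ℝ n).eval (2 / 3 : ℝ)

/-- `α_n ≥ 0`. [folklore] -/
theorem cardyCoeff_nonneg (n : ℕ) : 0 ≤ cardyCoeff n := by
  unfold cardyCoeff
  have h1 := ascPochhammer_pos n (1 / 3 : ℝ) (by norm_num)
  have h2 := ascPochhammer_pos n (2 / 3 : ℝ) (by norm_num)
  have h4 := ascPochhammer_pos n (4 / 3 : ℝ) (by norm_num)
  positivity

/-- `β_n ≥ 0`. [folklore] -/
theorem binomCoeff23_nonneg (n : ℕ) : 0 ≤ binomCoeff23 n := by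
  unfold binomCoeff23
  have h2 := ascPochhammer_pos n (2 / 3 : ℝ) (by norm_num)
  positivity

/-- The Pochhammer identity `(1/3) (4/3)_n = (1/3)_n (1/3 + n)`. [folklore] -/
theorem ascPochhammer_four_thirds (n : ℕ) :
    (1 / 3 : ℝ) * (ascPochhammer ℝ n).eval (4 / 3 : ℝ) =
      (ascPochhammer ℝ n).eval (1 / 3 : ℝ) * (1 / 3 + n) := by
  have h := ascPochhammer_succ_eval n (1 / 3 : ℝ)
  rw [ascPochhammer_succ_left, eval_mul, eval_X, eval_comp, eval_add, eval_X, eval_one,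
    show (1 / 3 : ℝ) + 1 = 4 / 3 by norm_num] at h
  exact h

/-- The coefficient identity `α_n (3n + 1) = β_n` behind Cardy's eq. (8),
`d/dη [3 η^{1/3} ₂F₁(η)] = η^{-2/3} (1 - η)^{-2/3}` (Cardy 1992, eq. (8)). [cite: Cardy1992, eq. (8)] -/
theorem cardyCoeff_mul (n : ℕ) : cardyCoeff n * (3 * n + 1) = binomCoeff23 n := by
  unfold cardyCoeff binomCoeff23
  have h1 := (ascPochhammer_pos n (1 / 3 : ℝ) (by norm_num)).ne'
  have h' : (ascPochhammer ℝ n).eval (4 / 3 : ℝ) =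
      (ascPochhammer ℝ n).eval (1 / 3 : ℝ) * (3 * n + 1) := by
    linear_combination (3 : ℝ) * ascPochhammer_four_thirds n
  rw [h']
  field_simp

/-- Mathlib's generalised binomial coefficient `Ring.choose (2/3 + n - 1) n` is `β_n = (2/3)_n / n!`. [folklore] -/
theorem ringChoose_eq_binomCoeff23 (n : ℕ) :
    Ring.choose ((2 / 3 : ℝ) + n - 1) n = binomCoeff23 n := by
  rw [Ring.choose_eq_smul, descPochhammer_smeval_eq_ascPochhammer, ascPochhammer_smeval_eq_eval,
    smul_eq_mul, binomCoeff23]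
  congr 2
  ring

/-- `|y| < 1` in the form needed for `Metric.eball`. [folklore] -/
theorem nnnorm_lt_one_of_abs_lt_one {y : ℝ} (hy : |y| < 1) : ‖y‖₊ < 1 := by
  rw [← NNReal.coe_lt_coe, coe_nnnorm, Real.norm_eq_abs]; exact hy

/-- The binomial series `∑ β_n y^n = (1 - y)^{-2/3}` for `|y| < 1` (Andrews–Askey–Roy 1999,
eq. (2.1.6); Mathlib `Real.one_div_one_sub_rpow_hasFPowerSeriesOnBall_zero`). [cite: AndrewsAskeyRoy1999, eq. (2.1.6)] -/
theorem hasSum_binomCoeff23 {y : ℝ} (hy : |y| < 1) :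
    HasSum (fun n ↦ binomCoeff23 n * y ^ n) (1 / (1 - y) ^ (2 / 3 : ℝ)) := by
  have hy' := nnnorm_lt_one_of_abs_lt_one hy
  have h := (Real.one_div_one_sub_rpow_hasFPowerSeriesOnBall_zero (2 / 3 : ℝ)).hasSum (y := y)
    (by simpa [Metric.mem_eball, enorm_eq_nnnorm] using hy')
  simp only [zero_add, FormalMultilinearSeries.ofScalars_apply_eq, smul_eq_mul,
    ringChoose_eq_binomCoeff23] at h
  exact h

/-- The Gauss series `∑ α_n x^n = ₂F₁(1/3, 2/3; 4/3; x)` for `|x| < 1` (Gauss 1812; Mathlib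
`ordinaryHypergeometricSeries_radius_eq_one`). [cite: Gauss1812] -/
theorem hasSum_cardyCoeff {x : ℝ} (hx : |x| < 1) :
    HasSum (fun n ↦ cardyCoeff n * x ^ n) (₂F₁ (1 / 3 : ℝ) (2 / 3 : ℝ) (4 / 3 : ℝ) x) := by
  have hx' := nnnorm_lt_one_of_abs_lt_one hx
  have h := (ordinaryHypergeometric_hasFPowerSeriesOnBall (𝔸 := ℝ) (1 / 3 : ℝ) (2 / 3) (4 / 3)
    cardy_params_ne_neg_nat).hasSum (y := x)
    (by simpa [Metric.mem_eball, enorm_eq_nnnorm] using hx')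
  simp only [zero_add, ordinaryHypergeometricSeries_apply_eq, smul_eq_mul] at h
  exact h

/-- Mathlib's `₂F₁(1/3,2/3;4/3;x)` is by definition the `tsum` `∑' α_n x^n` (junk where divergent). [folklore] -/
theorem ordinaryHypergeometric_cardy_eq_tsum (x : ℝ) :
    ₂F₁ (1 / 3 : ℝ) (2 / 3 : ℝ) (4 / 3 : ℝ) x = ∑' n, cardyCoeff n * x ^ n := by
  rw [ordinaryHypergeometric_eq_tsum]
  simp only [smul_eq_mul, cardyCoeff]

/-- `₂F₁(1/3,2/3;4/3;·)` is continuous on `(-1, 1)` (inside the disc of convergence). [cite: Gauss1812] -/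
theorem continuousOn_ordinaryHypergeometric_cardy :
    ContinuousOn (₂F₁ (1 / 3 : ℝ) (2 / 3 : ℝ) (4 / 3 : ℝ) : ℝ → ℝ) (Ioo (-1) 1) := by
  have h := (ordinaryHypergeometric_hasFPowerSeriesOnBall (𝔸 := ℝ) (1 / 3 : ℝ) (2 / 3) (4 / 3)
    cardy_params_ne_neg_nat).continuousOn
  refine h.mono fun x hx => ?_
  have := nnnorm_lt_one_of_abs_lt_one (abs_lt.2 hx)
  simpa [Metric.mem_eball, enorm_eq_nnnorm] using this

/-! ### The identity `3 η^{1/3} ₂F₁(1/3,2/3;4/3;η) = B(η; 1/3, 1/3)` on `[0, 1)` -/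

/-- `P(t) = t · ₂F₁(1/3,2/3;4/3;t³) = ∑ α_n t^{3n+1}`, i.e. `η^{1/3} ₂F₁(η)` in the variable
`t = η^{1/3}` (Cardy 1992, eq. (11)). [cite: Cardy1992, eq. (11)] -/
def cardyP (t : ℝ) : ℝ := t * ₂F₁ (1 / 3 : ℝ) (2 / 3 : ℝ) (4 / 3 : ℝ) (t ^ 3)

/-- `|t| < 1 → |t³| < 1`. [folklore] -/
theorem abs_pow_three_lt_one {t : ℝ} (ht : |t| < 1) : |t ^ 3| < 1 := by
  rw [abs_pow]; exact pow_lt_one₀ (abs_nonneg t) ht (by norm_num)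

/-- `P(t) = ∑ α_n t^{3n+1}` for `|t| < 1`. [cite: Gauss1812] -/
theorem hasSum_cardyP {t : ℝ} (ht : |t| < 1) :
    HasSum (fun n ↦ cardyCoeff n * t ^ (3 * n + 1)) (cardyP t) := by
  have h := (hasSum_cardyCoeff (abs_pow_three_lt_one ht)).mul_left t
  have e : (fun n ↦ cardyCoeff n * t ^ (3 * n + 1)) = fun n ↦ t * (cardyCoeff n * (t ^ 3) ^ n) := by
    ext n; rw [pow_succ, pow_mul]; ring
  rw [e]; exact h

/-- Termwise differentiation (Cardy 1992, eq. (8) in the variable `t = η^{1/3}`):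
`P'(t) = ∑ α_n (3n+1) t^{3n} = ∑ β_n (t³)^n = (1 - t³)^{-2/3}` for `|t| < 1`. [cite: Cardy1992, eq. (8)] -/
theorem hasDerivAt_cardyP {t : ℝ} (ht : |t| < 1) :
    HasDerivAt cardyP (1 / (1 - t ^ 3) ^ (2 / 3 : ℝ)) t := by
  -- work on the ball of radius `r`, `|t| < r < 1`
  obtain ⟨r, htr, hr1⟩ := exists_between ht
  have hr0 : 0 ≤ r := (abs_nonneg t).trans htr.le
  have hr3 : |r ^ 3| < 1 := by
    rw [abs_of_nonneg (pow_nonneg hr0 3)]; exact pow_lt_one₀ hr0 hr1 (by norm_num)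
  set g : ℕ → ℝ → ℝ := fun n s ↦ cardyCoeff n * s ^ (3 * n + 1)
  set g' : ℕ → ℝ → ℝ := fun n s ↦ cardyCoeff n * (3 * n + 1) * s ^ (3 * n)
  set u : ℕ → ℝ := fun n ↦ binomCoeff23 n * (r ^ 3) ^ n
  have hu : Summable u := (hasSum_binomCoeff23 hr3).summable
  have hg : ∀ n s, s ∈ Ioo (-r) r → HasDerivAt (g n) (g' n s) s := by
    intro n s _
    have := (hasDerivAt_pow (3 * n + 1) s).const_mul (cardyCoeff n)
    refine this.congr_deriv ?_
    show _ = cardyCoeff n * (3 * n + 1) * s ^ (3 * n)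
    rw [Nat.add_sub_cancel]
    push_cast
    ring
  have hg' : ∀ n s, s ∈ Ioo (-r) r → ‖g' n s‖ ≤ u n := by
    intro n s hs
    have hs' : |s| ≤ r := (abs_lt.2 hs).le
    simp only [g', u, Real.norm_eq_abs, ← cardyCoeff_mul]
    rw [abs_mul, abs_of_nonneg (mul_nonneg (cardyCoeff_nonneg n) (by positivity)), abs_pow,
      ← pow_mul]
    exact mul_le_mul_of_nonneg_left (pow_le_pow_left₀ (abs_nonneg s) hs' _)
      (mul_nonneg (cardyCoeff_nonneg n) (by positivity))
  have hg0 : Summable fun n ↦ g n 0 := by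
    simp only [g]
    refine summable_zero.congr fun n => ?_
    simp
  have hmem : t ∈ Ioo (-r) r := abs_lt.1 htr
  have hD := hasDerivAt_tsum_of_isPreconnected hu isOpen_Ioo (convex_Ioo (-r) r).isPreconnected
    hg hg' (by simpa using (abs_nonneg t).trans_lt htr : (0 : ℝ) ∈ Ioo (-r) r) hg0 hmem
  -- identify the sums
  have hsum' : (∑' n, g' n t) = 1 / (1 - t ^ 3) ^ (2 / 3 : ℝ) := by
    have := (hasSum_binomCoeff23 (abs_pow_three_lt_one ht)).tsum_eq
    rw [← this]
    refine tsum_congr fun n => ?_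
    simp only [g', ← cardyCoeff_mul, ← pow_mul]
  rw [hsum'] at hD
  refine hD.congr_of_eventuallyEq ?_
  -- `cardyP = ∑ g n` near `t`
  have : ∀ᶠ s in 𝓝 t, |s| < 1 := (isOpen_Iio.preimage continuous_abs).mem_nhds ht
  filter_upwards [this] with s hs
  exact ((hasSum_cardyP hs).tsum_eq).symm

/-- `t ↦ B(t³; 1/3, 1/3)` has derivative `(t³(1-t³))^{-2/3} · 3t² = 3 (1 - t³)^{-2/3}` on `(0, 1)`
(fundamental theorem of calculus and the chain rule). [folklore] -/
theorem hasDerivAt_incBeta13_cube {t : ℝ} (ht : t ∈ Ioo (0 : ℝ) 1) :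
    HasDerivAt (fun s ↦ incBeta13 (s ^ 3)) (3 / (1 - t ^ 3) ^ (2 / 3 : ℝ)) t := by
  have ht3 : t ^ 3 ∈ Ioo (0 : ℝ) 1 := ⟨pow_pos ht.1 3, pow_lt_one₀ ht.1.le ht.2 (by norm_num)⟩
  -- FTC for `incBeta13` at `x = t³`
  have hcont : ContinuousOn betaKernel13 (Ioo 0 1) := by
    intro x hx
    refine (ContinuousAt.rpow_const (by fun_prop) (Or.inl ?_)).continuousWithinAt
    exact (mul_pos hx.1 (by linarith [hx.2])).ne'
  have hI : HasDerivAt incBeta13 (betaKernel13 (t ^ 3)) (t ^ 3) := by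
    refine intervalIntegral.integral_hasDerivAt_right
      (intervalIntegrable_betaKernel13_of_mem ⟨le_rfl, zero_le_one⟩ ⟨ht3.1.le, ht3.2.le⟩) ?_ ?_
    · exact hcont.stronglyMeasurableAtFilter isOpen_Ioo _ ht3
    · exact hcont.continuousAt (isOpen_Ioo.mem_nhds ht3)
  have h : HasDerivAt (fun s ↦ incBeta13 (s ^ 3)) (betaKernel13 (t ^ 3) * (↑(3 : ℕ) * t ^ (3 - 1))) t :=
    HasDerivAt.comp (h := fun s : ℝ ↦ s ^ 3) t hI (hasDerivAt_pow 3 t)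
  convert h using 1
  -- `betaKernel13 (t³) · 3 t² = 3 (1 - t³)^{-2/3}`
  have ht0 : 0 ≤ t := ht.1.le
  have h1 : 0 ≤ 1 - t ^ 3 := by linarith [ht3.2]
  simp only [betaKernel13]
  rw [Real.mul_rpow (pow_nonneg ht0 3) h1, ← Real.rpow_natCast t 3, ← Real.rpow_mul ht0]
  norm_num
  rw [Real.rpow_neg h1]
  have ht' : t ≠ 0 := ht.1.ne'
  have : t ^ 2 ≠ 0 := pow_ne_zero 2 ht'
  have h2 : (1 - t ^ 3) ^ (2 / 3 : ℝ) ≠ 0 := (Real.rpow_pos_of_pos (by linarith [ht3.2]) _).ne'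
  field_simp

/-- Continuity of `t ↦ B(t³; 1/3, 1/3)` on `[0, 1]`. [folklore] -/
theorem continuousOn_incBeta13_cube : ContinuousOn (fun s : ℝ ↦ incBeta13 (s ^ 3)) (Icc 0 1) := by
  refine incBeta13_continuousOn.comp (by fun_prop) fun s hs => ?_
  exact ⟨pow_nonneg hs.1 3, pow_le_one₀ hs.1 hs.2⟩

/-- Continuity of `P` on `(-1, 1)`. [folklore] -/
theorem continuousOn_cardyP : ContinuousOn cardyP (Ioo (-1) 1) := by
  refine continuousOn_id.mul (continuousOn_ordinaryHypergeometric_cardy.comp (by fun_prop) ?_)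
  intro s hs
  exact abs_lt.1 (abs_pow_three_lt_one (abs_lt.2 hs))

/-- `3 P(t) = B(t³; 1/3, 1/3)` for `t ∈ [0, 1)`: both sides vanish at `0` and have the same
derivative on `(0, 1)` (Cardy 1992, eqs. (8), (11)). [cite: Cardy1992, eqs. (8), (11)] -/
theorem three_mul_cardyP_eq {t : ℝ} (ht : t ∈ Ico (0 : ℝ) 1) : 3 * cardyP t = incBeta13 (t ^ 3) := by
  set K : ℝ → ℝ := fun s ↦ 3 * cardyP s - incBeta13 (s ^ 3) with hK
  have hK0 : K 0 = 0 := by simp [hK, cardyP, incBeta13_zero]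
  suffices K t = 0 by simpa [hK, sub_eq_zero] using this
  rcases ht.1.eq_or_lt with h0 | h0
  · rw [← h0]; exact hK0
  -- `K` is constant on `[s, t]` for `0 < s ≤ t`
  have hderiv : ∀ x ∈ Ioo (0 : ℝ) 1, HasDerivAt K 0 x := by
    intro x hx
    have hx' : |x| < 1 := abs_lt.2 ⟨by linarith [hx.1], hx.2⟩
    have := ((hasDerivAt_cardyP hx').const_mul 3).sub (hasDerivAt_incBeta13_cube hx)
    have h3 : (3 : ℝ) * (1 / (1 - x ^ 3) ^ (2 / 3 : ℝ)) - 3 / (1 - x ^ 3) ^ (2 / 3 : ℝ) = 0 := by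
      ring
    rw [h3] at this
    exact this
  have hKcont : ContinuousOn K (Icc 0 t) := by
    refine ContinuousOn.sub (continuousOn_const.mul (continuousOn_cardyP.mono ?_))
      (continuousOn_incBeta13_cube.mono ?_)
    · exact fun s hs => ⟨by linarith [hs.1], hs.2.trans_lt ht.2⟩
    · exact fun s hs => ⟨hs.1, hs.2.trans ht.2.le⟩
  have hconst : ∀ s ∈ Ioo (0 : ℝ) t, K s = K t := by
    intro s hs
    have h := constant_of_has_deriv_right_zero (f := K) (a := s) (b := t)
      (hKcont.mono fun x hx => ⟨hs.1.le.trans hx.1, hx.2⟩) ?_ t ⟨hs.2.le, le_rfl⟩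
    · exact h.symm
    · intro x hx
      exact (hderiv x ⟨hs.1.trans_le hx.1, hx.2.trans ht.2⟩).hasDerivWithinAt
  -- pass to the limit `s → 0⁺`
  haveI : (𝓝[Ioo (0 : ℝ) t] 0).NeBot := by
    rw [← mem_closure_iff_nhdsWithin_neBot, closure_Ioo h0.ne]
    exact ⟨le_rfl, h0.le⟩
  have h1 : Tendsto K (𝓝[Ioo (0 : ℝ) t] 0) (𝓝 (K 0)) :=
    (hKcont 0 ⟨le_rfl, h0.le⟩).tendsto.mono_left (nhdsWithin_mono _ Ioo_subset_Icc_self)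
  have h2 : Tendsto K (𝓝[Ioo (0 : ℝ) t] 0) (𝓝 (K t)) :=
    tendsto_const_nhds.congr' (eventually_mem_nhdsWithin.mono fun s hs => (hconst s hs).symm)
  rw [tendsto_nhds_unique h2 h1, hK0]

/-- **`3 η^{1/3} ₂F₁(1/3, 2/3; 4/3; η) = B(η; 1/3, 1/3)` for `η ∈ [0, 1)`** (Gauss's
`B_x(a,b) = (x^a/a) ₂F₁(a, 1-b; a+1; x)`, Beals–Wong 2016, §10.7 Exercise 4, at `a = b = 1/3`; the
symmetric `₂F₁(a,b;c;·) = ₂F₁(b,a;c;·)` is built into the coefficients). [cite: BealsWong2016, §10.7 Exercise 4] -/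
theorem three_mul_rpow_mul_hypergeometric_eq_incBeta13 {η : ℝ} (hη : η ∈ Ico (0 : ℝ) 1) :
    3 * η ^ (1 / 3 : ℝ) * ₂F₁ (1 / 3 : ℝ) (2 / 3 : ℝ) (4 / 3 : ℝ) η = incBeta13 η := by
  have ht : η ^ (1 / 3 : ℝ) ∈ Ico (0 : ℝ) 1 :=
    ⟨Real.rpow_nonneg hη.1 _, Real.rpow_lt_one hη.1 hη.2 (by norm_num)⟩
  have h3 : (η ^ (1 / 3 : ℝ)) ^ 3 = η := by
    rw [← Real.rpow_natCast, ← Real.rpow_mul hη.1]; norm_num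
  have := three_mul_cardyP_eq ht
  rw [cardyP, h3] at this
  linarith [this]

/-! ### The endpoint `η = 1`: Gauss's sum via Abel's limit theorem -/

/-- On `(0, 1)`, `₂F₁(1/3,2/3;4/3;x) = B(x; 1/3,1/3) / (3 x^{1/3})`. [cite: BealsWong2016, §10.7 Exercise 4] -/
theorem hypergeometric_cardy_eq_incBeta13_div {x : ℝ} (hx : x ∈ Ioo (0 : ℝ) 1) :
    ₂F₁ (1 / 3 : ℝ) (2 / 3 : ℝ) (4 / 3 : ℝ) x = incBeta13 x / (3 * x ^ (1 / 3 : ℝ)) := by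
  have h2 := three_mul_rpow_mul_hypergeometric_eq_incBeta13 ⟨hx.1.le, hx.2⟩
  have h5 : 0 < x ^ (1 / 3 : ℝ) := Real.rpow_pos_of_pos hx.1 _
  rw [← h2]; field_simp

/-- Partial sums of the Gauss series at `1` are bounded by `B(1/3,1/3)/3`: let `x → 1⁻` in
`∑_{n<N} α_n x^n ≤ ₂F₁(x) = B(x)/(3x^{1/3}) ≤ B(1)/(3x^{1/3})` (`α_n ≥ 0`). [folklore] -/
theorem sum_range_cardyCoeff_le (N : ℕ) :
    ∑ n ∈ Finset.range N, cardyCoeff n ≤ incBeta13 1 / 3 := by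
  have key : ∀ x ∈ Ioo (0 : ℝ) 1,
      ∑ n ∈ Finset.range N, cardyCoeff n * x ^ n ≤ incBeta13 1 / 3 * (x ^ (1 / 3 : ℝ))⁻¹ := by
    intro x hx
    have hx' : |x| < 1 := abs_lt.2 ⟨by linarith [hx.1], hx.2⟩
    have h1 : ∑ n ∈ Finset.range N, cardyCoeff n * x ^ n ≤ ₂F₁ (1 / 3 : ℝ) (2 / 3 : ℝ) (4 / 3 : ℝ) x :=
      sum_le_hasSum (Finset.range N) (fun n _ => mul_nonneg (cardyCoeff_nonneg n) (pow_nonneg hx.1.le n))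
        (hasSum_cardyCoeff hx')
    have h3 : incBeta13 x ≤ incBeta13 1 :=
      strictMonoOn_incBeta13.monotoneOn ⟨hx.1.le, hx.2.le⟩ ⟨zero_le_one, le_rfl⟩ hx.2.le
    have h5 : 0 < x ^ (1 / 3 : ℝ) := Real.rpow_pos_of_pos hx.1 _
    calc ∑ n ∈ Finset.range N, cardyCoeff n * x ^ n ≤ _ := h1
      _ = incBeta13 x / (3 * x ^ (1 / 3 : ℝ)) := hypergeometric_cardy_eq_incBeta13_div hx
      _ ≤ incBeta13 1 / (3 * x ^ (1 / 3 : ℝ)) := div_le_div_of_nonneg_right h3 (by positivity)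
      _ = incBeta13 1 / 3 * (x ^ (1 / 3 : ℝ))⁻¹ := by ring
  have hlim1 : Tendsto (fun x : ℝ => ∑ n ∈ Finset.range N, cardyCoeff n * x ^ n) (𝓝[<] 1)
      (𝓝 (∑ n ∈ Finset.range N, cardyCoeff n)) := by
    have hc : Continuous fun x : ℝ => ∑ n ∈ Finset.range N, cardyCoeff n * x ^ n := by fun_prop
    have h := hc.tendsto 1
    simp only [one_pow, mul_one] at h
    exact h.mono_left nhdsWithin_le_nhds
  have hlim2 : Tendsto (fun x : ℝ => incBeta13 1 / 3 * (x ^ (1 / 3 : ℝ))⁻¹) (𝓝[<] 1)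
      (𝓝 (incBeta13 1 / 3)) := by
    have hc : ContinuousAt (fun x : ℝ => incBeta13 1 / 3 * (x ^ (1 / 3 : ℝ))⁻¹) 1 := by
      refine continuousAt_const.mul ((Real.continuousAt_rpow_const _ _ (Or.inl one_ne_zero)).inv₀ ?_)
      simp
    have h := hc.tendsto
    simp only [Real.one_rpow, inv_one, mul_one] at h
    exact h.mono_left nhdsWithin_le_nhds
  refine le_of_tendsto_of_tendsto hlim1 hlim2 ?_
  filter_upwards [Ioo_mem_nhdsLT one_pos] with x hx using key x hx

/-- The Gauss series `∑ α_n` of `₂F₁(1/3, 2/3; 4/3; 1)` converges (`c - a - b = 1/3 > 0`;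
Andrews–Askey–Roy 1999, Thm 2.1.2). This is `Literature.Probability.RandomPlanarGeometry.summable_ordinaryHypergeometricSeries_cardy_one`
up to unfolding. [cite: AndrewsAskeyRoy1999, Thm 2.1.2] -/
theorem summable_cardyCoeff : Summable cardyCoeff :=
  summable_of_sum_range_le cardyCoeff_nonneg sum_range_cardyCoeff_le

/-- Continuity of `B(·; 1/3,1/3)` at `1` from the left. [folklore] -/
theorem tendsto_incBeta13_nhdsLT_one : Tendsto incBeta13 (𝓝[<] 1) (𝓝 (incBeta13 1)) := by
  have h : ContinuousWithinAt incBeta13 (Iio 1) 1 :=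
    (incBeta13_continuousOn 1 ⟨zero_le_one, le_rfl⟩).mono_of_mem_nhdsWithin
      (mem_of_superset (Ioo_mem_nhdsLT one_pos) Ioo_subset_Icc_self)
  exact h.tendsto

/-- **Gauss's summation theorem at `(1/3, 2/3; 4/3)`** in the form
`3 · ₂F₁(1/3, 2/3; 4/3; 1) = B(1/3, 1/3)` (`= Γ(1/3)²/Γ(2/3)`, i.e.
`₂F₁(1/3,2/3;4/3;1) = Γ(4/3)Γ(1/3)/(Γ(1)Γ(2/3))`, Andrews–Askey–Roy 1999, Thm 2.2.2), obtained here
from the identity on `[0, 1)` by Abel's limit theorem (Mathlib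
`Real.tendsto_tsum_powerSeries_nhdsWithin_lt`). [cite: AndrewsAskeyRoy1999, Thm 2.2.2] -/
theorem three_mul_hypergeometric_one_eq_incBeta13_one :
    3 * ₂F₁ (1 / 3 : ℝ) (2 / 3 : ℝ) (4 / 3 : ℝ) (1 : ℝ) = incBeta13 1 := by
  -- Abel: `∑ α_n x^n → ∑ α_n` as `x → 1⁻`
  have hA : Tendsto (fun x : ℝ => ∑' n, cardyCoeff n * x ^ n) (𝓝[<] 1) (𝓝 (∑' n, cardyCoeff n)) :=
    Real.tendsto_tsum_powerSeries_nhdsWithin_lt summable_cardyCoeff.hasSum.tendsto_sum_nat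
  -- the same function is `incBeta13 x / (3 x^{1/3})` on `(0, 1)`, which tends to `incBeta13 1 / 3`
  have hB : Tendsto (fun x : ℝ => incBeta13 x / (3 * x ^ (1 / 3 : ℝ))) (𝓝[<] 1)
      (𝓝 (incBeta13 1 / 3)) := by
    have h3 : Tendsto (fun x : ℝ => 3 * x ^ (1 / 3 : ℝ)) (𝓝[<] 1) (𝓝 3) := by
      have hc : ContinuousAt (fun x : ℝ => 3 * x ^ (1 / 3 : ℝ)) 1 :=
        continuousAt_const.mul (Real.continuousAt_rpow_const _ _ (Or.inl one_ne_zero))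
      have h := hc.tendsto
      simp only [Real.one_rpow, mul_one] at h
      exact h.mono_left nhdsWithin_le_nhds
    exact tendsto_incBeta13_nhdsLT_one.div h3 three_ne_zero
  have hAB : (fun x : ℝ => ∑' n, cardyCoeff n * x ^ n) =ᶠ[𝓝[<] 1]
      fun x : ℝ => incBeta13 x / (3 * x ^ (1 / 3 : ℝ)) := by
    filter_upwards [Ioo_mem_nhdsLT one_pos] with x hx
    have hx' : |x| < 1 := abs_lt.2 ⟨by linarith [hx.1], hx.2⟩
    rw [(hasSum_cardyCoeff hx').tsum_eq, hypergeometric_cardy_eq_incBeta13_div hx]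
  have hlim : (∑' n, cardyCoeff n) = incBeta13 1 / 3 := tendsto_nhds_unique_of_eventuallyEq hA hB hAB
  have h1 : ₂F₁ (1 / 3 : ℝ) (2 / 3 : ℝ) (4 / 3 : ℝ) (1 : ℝ) = ∑' n, cardyCoeff n := by
    rw [ordinaryHypergeometric_cardy_eq_tsum]; simp
  rw [h1, hlim]; ring

/-- **`3 η^{1/3} ₂F₁(1/3, 2/3; 4/3; η) = B(η; 1/3, 1/3)` on the closed interval `[0, 1]`**
(Beals–Wong 2016, §10.7 Exercise 4, plus Gauss's summation at the endpoint). [cite: BealsWong2016, §10.7 Exercise 4] -/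
theorem three_mul_rpow_mul_hypergeometric_eq_incBeta13' {η : ℝ} (hη : η ∈ Icc (0 : ℝ) 1) :
    3 * η ^ (1 / 3 : ℝ) * ₂F₁ (1 / 3 : ℝ) (2 / 3 : ℝ) (4 / 3 : ℝ) η = incBeta13 η := by
  rcases hη.2.eq_or_lt with h1 | h1
  · rw [h1, Real.one_rpow, mul_one, three_mul_hypergeometric_one_eq_incBeta13_one]
  · exact three_mul_rpow_mul_hypergeometric_eq_incBeta13 ⟨hη.1, h1⟩

/-- **Discharge of the named fact `Literature.Probability.RandomPlanarGeometry.cardyFunction_eq_incBeta13_div`**: Cardy's function is the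
regularised incomplete beta function, `F(η) = B(η; 1/3,1/3) / B(1/3,1/3)` on `[0, 1]`
(Cardy 1992, eqs. (8), (11); Beals–Wong 2016, §10.7 Exercise 4; Andrews–Askey–Roy 1999,
Thm 1.1.4 and Thm 2.2.2). [cite: BealsWong2016, §10.7 Exercise 4] -/
theorem cardyFunction_eq_incBeta13_div_holds : cardyFunction_eq_incBeta13_div := by
  intro η hη
  have hB : incBeta13 1 ≠ 0 := incBeta13_one_pos.ne'
  have hc : cardyConst = 3 / incBeta13 1 := by
    rw [eq_div_iff hB, cardyConst_mul_incBeta13_one]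
  rw [cardyFunction_eq_cardyConst_mul, hc, ← three_mul_rpow_mul_hypergeometric_eq_incBeta13' hη]
  field_simp

/-- Corollary: **`F(1) = 1`** (`Literature.Probability.RandomPlanarGeometry.cardyFunction_one`, Gauss's summation theorem; Cardy 1992,
below eq. (11)). [cite: AndrewsAskeyRoy1999, Thm 2.2.2] -/
theorem cardyFunction_one_holds : cardyFunction_one := by
  have h := cardyFunction_eq_incBeta13_div_holds 1 ⟨zero_le_one, le_rfl⟩
  rwa [div_self incBeta13_one_pos.ne'] at h

/-- Corollary: **`F` is strictly increasing on `[0, 1]`** (`Literature.Probability.RandomPlanarGeometry.strictMonoOn_cardyFunction`;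
Cardy 1992, eq. (8): the derivative is positive). [cite: Cardy1992, eq. (8)] -/
theorem strictMonoOn_cardyFunction_holds : strictMonoOn_cardyFunction := by
  intro a ha b hb hab
  rw [cardyFunction_eq_incBeta13_div_holds a ha, cardyFunction_eq_incBeta13_div_holds b hb]
  exact div_lt_div_of_pos_right (strictMonoOn_incBeta13 ha hb hab) incBeta13_one_pos

/-- Corollary: **`F` is continuous on `[0, 1]`** (`Literature.Probability.RandomPlanarGeometry.continuousOn_cardyFunction`; Cardy 1992). [cite: Cardy1992, eq. (8)] -/
theorem continuousOn_cardyFunction_holds : continuousOn_cardyFunction := by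
  refine (incBeta13_continuousOn.div_const (incBeta13 1)).congr fun η hη => ?_
  exact cardyFunction_eq_incBeta13_div_holds η hη

/-- Corollary: **`F(1 - η) = 1 - F(η)`** on `[0, 1]` (`Literature.Probability.RandomPlanarGeometry.cardyFunction_one_sub`; Cardy 1992,
discussion after eq. (11); from `B(1-u) = B(1) - B(u)`). [cite: Cardy1992, discussion after eq. (11)] -/
theorem cardyFunction_one_sub_holds : cardyFunction_one_sub := by
  intro η hη
  have hη' : 1 - η ∈ Icc (0 : ℝ) 1 := ⟨by linarith [hη.2], by linarith [hη.1]⟩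
  rw [cardyFunction_eq_incBeta13_div_holds _ hη', cardyFunction_eq_incBeta13_div_holds η hη,
    incBeta13_one_sub hη, sub_div, div_self incBeta13_one_pos.ne']

/-- Corollary: **`F` maps `[0, 1]` into `[0, 1]`** (`Literature.Probability.RandomPlanarGeometry.cardyFunction_mem_Icc`; Cardy 1992). [cite: Cardy1992, eq. (11)] -/
theorem cardyFunction_mem_Icc_holds : cardyFunction_mem_Icc := by
  intro η hη
  rw [cardyFunction_eq_incBeta13_div_holds η hη]
  refine ⟨div_nonneg (incBeta13_nonneg hη) incBeta13_one_pos.le, ?_⟩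
  rw [div_le_one incBeta13_one_pos]
  exact strictMonoOn_incBeta13.monotoneOn hη ⟨zero_le_one, le_rfl⟩ hη.2

/-- Corollary: the summability fact `Literature.Probability.RandomPlanarGeometry.summable_ordinaryHypergeometricSeries_cardy_one` (the Gauss
series of `₂F₁(1/3,2/3;4/3;·)` converges at `1`). [cite: AndrewsAskeyRoy1999, Thm 2.1.2] -/
theorem summable_ordinaryHypergeometricSeries_cardy_one_holds :
    summable_ordinaryHypergeometricSeries_cardy_one := by
  unfold summable_ordinaryHypergeometricSeries_cardy_one
  refine summable_cardyCoeff.congr fun n => ?_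
  rw [ordinaryHypergeometricSeries_apply_eq]
  simp [cardyCoeff]

/-- Corollary: **Cardy's differential equation** `F'(η) = (cardyConst/3) (η(1-η))^{-2/3}` on
`(0, 1)` (`Literature.Probability.RandomPlanarGeometry.hasDerivAt_cardyFunction`; Cardy 1992, eq. (8)): by the fundamental theorem of
calculus for `B(·; 1/3, 1/3)` and `cardyConst · B(1/3,1/3) = 3`. [cite: Cardy1992, eq. (8)] -/
theorem hasDerivAt_cardyFunction_holds : hasDerivAt_cardyFunction := by
  intro η hη
  have hcont : ContinuousOn betaKernel13 (Ioo 0 1) := by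
    intro x hx
    refine (ContinuousAt.rpow_const (by fun_prop) (Or.inl ?_)).continuousWithinAt
    exact (mul_pos hx.1 (by linarith [hx.2])).ne'
  have hI : HasDerivAt incBeta13 (betaKernel13 η) η := by
    refine intervalIntegral.integral_hasDerivAt_right
      (intervalIntegrable_betaKernel13_of_mem ⟨le_rfl, zero_le_one⟩ ⟨hη.1.le, hη.2.le⟩) ?_ ?_
    · exact hcont.stronglyMeasurableAtFilter isOpen_Ioo _ hη
    · exact hcont.continuousAt (isOpen_Ioo.mem_nhds hη)
  have hEq : cardyFunction =ᶠ[𝓝 η] fun u => incBeta13 u / incBeta13 1 := by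
    filter_upwards [isOpen_Ioo.mem_nhds hη] with u hu
    exact cardyFunction_eq_incBeta13_div_holds u ⟨hu.1.le, hu.2.le⟩
  have hB : incBeta13 1 ≠ 0 := incBeta13_one_pos.ne'
  have hc : cardyConst / 3 = (incBeta13 1)⁻¹ := by
    rw [div_eq_iff (by norm_num : (3 : ℝ) ≠ 0), eq_comm, inv_mul_eq_iff_eq_mul₀ hB,
      mul_comm, cardyConst_mul_incBeta13_one]
  refine ((hI.div_const (incBeta13 1)).congr_of_eventuallyEq hEq).congr_deriv ?_
  rw [hc, betaKernel13, div_eq_inv_mul]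

/-- Corollary: **crit-perc.S17**'s `Literature.Probability.RandomPlanarGeometry.cardyFunction_props` (`F(0) = 0`, `F(1) = 1`,
continuity, strict monotonicity, `F(1-η) = 1 - F(η)`). [cite: Werner2007, §3] -/
theorem cardyFunction_props_holds : RandomPlanarGeometry.cardyFunction_props :=
  ⟨cardyFunction_zero, cardyFunction_one_holds, continuousOn_cardyFunction_holds,
    strictMonoOn_cardyFunction_holds, fun _ h => cardyFunction_one_sub_holds h⟩

end Literature.Probability.RandomPlanarGeometry
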